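import Literature.Topology.FourManifolds.SurfaceGroupCutKernels
import Mathlib.Tactic.Group
import HarnessLib

/-!
# Automorphisms of the surface group stabilising cut kernels, I: signed letter permutations
# on `H₁`, the letter-conjugating sign flip, the meridian twist and the cut swap

Topic `Literature/Topology/FourManifolds`; theorems only (no definitions, no named facts), over
`SurfaceGroupCutKernels.lean` (erasure test `mem_cutKernel_iff`, `map_cutKernel_eq_of`),
`SurfaceGroupGeneratorImages.lean` (`equivOfGens`, `localGens`) and `SurfaceGroupHomology.lean`
(`SurfaceGroup.abelianize`, the moves `moveX`, …).  First instalment of the list of explicit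
automorphisms of `S_g = ⟨a₀,b₀,…,a_{g-1},b_{g-1} ∣ ∏[aᵢ,bᵢ]⟩` used to show that the GOERITZ GROUP
of a pair of cut systems (the automorphisms stabilising both cut kernels, Zieschang–Vogt–
Coldewey §3.6, Griffiths 1964) realises every integral symplectic automorphism of `H₁` stabilising
the two coordinate Lagrangians.  "`x` realises `F`" is written out as
`∀ s, toAdd (abelianize (x s)) = F (toAdd (abelianize s))`.

* `exists_signedPerm` — for a permutation `τ` of the letters and signs `σ = ±1` there is a
  `ℤ`-linear automorphism `E` of `ℤ^{2g}` with `(E v)_p = σ_p v_{τ p}` (all homology actions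
  below are of this shape or elementary moves);
* `SurfaceGroup.exists_realises_signFlip` — the LETTER-CONJUGATING SIGN FLIP of handle `j`
  (`aⱼ ↦ [aⱼ,bⱼ]aⱼ⁻¹`, `bⱼ ↦ aⱼbⱼ⁻¹aⱼ⁻¹`, fixing `[aⱼ,bⱼ]` on the nose): it stabilises EVERY cut
  kernel and acts on `H₁` by `-1` on handle `j`;
* `SurfaceGroup.exists_realises_moveX_cut` — the MERIDIAN TWIST `bⱼ ↦ bⱼaⱼ` (ZVC 3.6.9 (A)): it
  stabilises every cut kernel cutting `aⱼ` and realises `moveX j 1`;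
* `SurfaceGroup.exists_realises_cutSwapEquiv` — the homology action of the cut swap
  `cutSwapEquiv d` (`aᵢ ↦ bᵢ`, `bᵢ ↦ -aᵢ` on the handles of `d`).

## References

* H. Zieschang, E. Vogt, H.-D. Coldewey, *Surfaces and Planar Discontinuous Groups*, LNM 835
  (1980), §3.6 (3.6.7, 3.6.9). [ZieschangVogtColdewey1980]
* H. B. Griffiths, *Automorphisms of a 3-dimensional handlebody*, Abh. Math. Sem. Univ. Hamburg 26
  (1964) 191–210. [GriffithsHB1964Handlebody]
-/

noncomputable section

namespace Literature.Topology.FourManifolds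

open Multiplicative Subgroup

/-! ## Signed letter permutations of `ℤ^X` -/

/-- **Signed permutations of the letters**: for a permutation `τ` of `X` and signs `σ : X → {±1}`
there is a `ℤ`-linear automorphism `E` of `ℤ^X` with `(E v)_p = σ_p · v_{τ p}`; on basis vectors
`E δ_x = σ_{τ⁻¹x} δ_{τ⁻¹ x}`. [folklore] -/
theorem exists_signedPerm {X : Type*} [DecidableEq X] (τ : Equiv.Perm X) (σ : X → ℤ)
    (hσ : ∀ p, σ p = 1 ∨ σ p = -1) :
    ∃ E : (X → ℤ) ≃ₗ[ℤ] (X → ℤ), (∀ v p, E v p = σ p * v (τ p)) ∧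
      ∀ x n, E (Pi.single x n) = Pi.single (τ.symm x) (σ (τ.symm x) * n) := by
  let E : (X → ℤ) ≃ₗ[ℤ] (X → ℤ) :=
    (LinearEquiv.funCongrLeft ℤ ℤ τ).trans
      (LinearEquiv.piCongrRight fun p => if σ p = 1 then LinearEquiv.refl ℤ ℤ else LinearEquiv.neg ℤ)
  have hE : ∀ v p, E v p = σ p * v (τ p) := by
    intro v p
    simp only [E, LinearEquiv.trans_apply, LinearEquiv.piCongrRight_apply,
      LinearEquiv.funCongrLeft_apply, LinearMap.funLeft_apply]
    rcases hσ p with h | h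
    · rw [h]; simp
    · rw [h]; simp [LinearEquiv.neg_apply]
  refine ⟨E, hE, fun x n => ?_⟩
  funext p
  rw [hE, Pi.single_apply, Pi.single_apply]
  by_cases hp : p = τ.symm x
  · subst hp
    simp
  · have : τ p ≠ x := fun h => hp (by rw [← h, Equiv.symm_apply_apply])
    rw [if_neg this, if_neg hp, mul_zero]

namespace SurfaceGroup

variable {g : ℕ}

/-! ## Exponent sums of the letters and of the middle block -/

/-- `abelianize aᵢ = δ_{aᵢ}`. [folklore] -/
@[simp] theorem abelianize_a (i : Fin g) :
    SurfaceGroup.abelianize g (a i) = ofAdd (Pi.single (i, false) 1) :=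
  SurfaceGroup.abelianize_of _

/-- `abelianize bᵢ = δ_{bᵢ}`. [folklore] -/
@[simp] theorem abelianize_b (i : Fin g) :
    SurfaceGroup.abelianize g (b i) = ofAdd (Pi.single (i, true) 1) :=
  SurfaceGroup.abelianize_of _

/-- The middle block `mid k l = ∏_{k<h<l}[a_h,b_h]` is a product of commutators, invisible in
`H₁`. [folklore] -/
@[simp] theorem abelianize_mid (k l : ℕ) :
    SurfaceGroup.abelianize g (mid k l) = 1 := by
  unfold mid
  rw [map_list_prod, List.map_map]
  refine List.prod_eq_one fun x hx => ?_
  obtain ⟨i, -, rfl⟩ := List.mem_map.1 hx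
  rw [Function.comp_apply, map_relFactor]
  unfold relFactor
  split_ifs
  · simp only [Function.comp_apply]
    rw [mul_inv_cancel_comm, mul_inv_cancel]
  · rfl

/-! ## The letter-conjugating sign flip of a handle -/

/-- **The letter-conjugating sign flip** of handle `j`: the automorphism
`aⱼ ↦ [aⱼ,bⱼ]aⱼ⁻¹ = aⱼbⱼaⱼ⁻¹bⱼ⁻¹aⱼ⁻¹`, `bⱼ ↦ aⱼbⱼ⁻¹aⱼ⁻¹` (inverse `aⱼ ↦ bⱼaⱼ⁻¹bⱼ⁻¹`,
`bⱼ ↦ [bⱼ,aⱼ]bⱼ⁻¹`), identity on the other handles, fixes `[aⱼ,bⱼ]` on the nose, sends every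
letter to a conjugate of itself or its inverse — hence stabilises EVERY cut kernel — and acts on
`H₁` by the sign change `E` of handle `j` (`δ_{aⱼ} ↦ -δ_{aⱼ}`, `δ_{bⱼ} ↦ -δ_{bⱼ}`; an
orientation-preserving involution of `H₁`, the hyperelliptic-type rotation of the handle).
[folklore] -/
theorem exists_realises_signFlip (j : Fin g) :
    ∃ (x : SurfaceGroup g ≃* SurfaceGroup g) (E : (surfaceGen g → ℤ) ≃ₗ[ℤ] (surfaceGen g → ℤ)),
      (∀ v p, E v p = (if p.1 = j then -1 else 1) * v p) ∧
      (∀ c : Fin g → Bool, (cutKernel c).map x.toMonoidHom = cutKernel c) ∧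
      ∀ s, toAdd (SurfaceGroup.abelianize g (x s)) = E (toAdd (SurfaceGroup.abelianize g s)) := by
  obtain ⟨E, hE, hEs⟩ := exists_signedPerm (Equiv.refl (surfaceGen g))
    (fun p => if p.1 = j then -1 else 1) (fun p => by by_cases h : p.1 = j <;> simp [h])
  let x : SurfaceGroup g ≃* SurfaceGroup g :=
    equivOfGens
      (localGens (fun i => if i = j then a j * b j * (a j)⁻¹ * (b j)⁻¹ * (a j)⁻¹ else a i)
        (fun i => if i = j then a j * (b j)⁻¹ * (a j)⁻¹ else b i))
      (localGens (fun i => if i = j then b j * (a j)⁻¹ * (b j)⁻¹ else a i)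
        (fun i => if i = j then b j * a j * (b j)⁻¹ * (a j)⁻¹ * (b j)⁻¹ else b i))
      (prod_relFactor_localGens _ _ fun i => by
        by_cases hi : i = j
        · subst hi; simp only [if_true]; group
        · simp [hi])
      (prod_relFactor_localGens _ _ fun i => by
        by_cases hi : i = j
        · subst hi; simp only [if_true]; group
        · simp [hi])
      (by
        rintro ⟨i, _ | _⟩
        · by_cases hi : i = j
          · subst hi; rw [← a_def]; simp [map_mul, map_inv]; group
          · rw [← a_def]; simp [hi]
        · by_cases hi : i = j
          · subst hi; rw [← b_def]; simp [map_mul, map_inv]; group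
          · rw [← b_def]; simp [hi])
      (by
        rintro ⟨i, _ | _⟩
        · by_cases hi : i = j
          · subst hi; rw [← a_def]; simp [map_mul, map_inv]; group
          · rw [← a_def]; simp [hi]
        · by_cases hi : i = j
          · subst hi; rw [← b_def]; simp [map_mul, map_inv]; group
          · rw [← b_def]; simp [hi])
  have hxa : ∀ i, x (a i) = if i = j then a j * b j * (a j)⁻¹ * (b j)⁻¹ * (a j)⁻¹ else a i :=
    fun i => by simp [x, a_def i]
  have hxb : ∀ i, x (b i) = if i = j then a j * (b j)⁻¹ * (a j)⁻¹ else b i :=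
    fun i => by simp [x, b_def i]
  have hxa' : ∀ i, x.symm (a i) = if i = j then b j * (a j)⁻¹ * (b j)⁻¹ else a i :=
    fun i => by simp [x, a_def i]
  have hxb' : ∀ i, x.symm (b i) = if i = j then b j * a j * (b j)⁻¹ * (a j)⁻¹ * (b j)⁻¹ else b i :=
    fun i => by simp [x, b_def i]
  refine ⟨x, E, hE, fun c => ?_, ?_⟩
  · -- every cut kernel is stabilised: each cut letter goes to (a conjugate of) its inverse
    refine map_cutKernel_eq_of x c c (fun i => ?_) (fun i => ?_)
    · by_cases hi : i = j
      · subst hi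
        cases hc : c i
        · rw [← a_def, hxa, if_pos rfl]
          simp only [map_mul, map_inv, erase_a_of_eq_false c hc]
          group
        · rw [← b_def, hxb, if_pos rfl]
          simp only [map_mul, map_inv, erase_b_of_eq_true c hc]
          group
      · cases hc : c i
        · rw [← a_def, hxa, if_neg hi]; exact erase_a_of_eq_false c hc
        · rw [← b_def, hxb, if_neg hi]; exact erase_b_of_eq_true c hc
    · by_cases hi : i = j
      · subst hi
        cases hc : c i
        · rw [← a_def, hxa', if_pos rfl]
          simp only [map_mul, map_inv, erase_a_of_eq_false c hc]
          group
        · rw [← b_def, hxb', if_pos rfl]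
          simp only [map_mul, map_inv, erase_b_of_eq_true c hc]
          group
      · cases hc : c i
        · rw [← a_def, hxa', if_neg hi]; exact erase_a_of_eq_false c hc
        · rw [← b_def, hxb', if_neg hi]; exact erase_b_of_eq_true c hc
  · -- the homology action
    refine abelianize_comp_eq_of_apply_of x E ?_
    rintro ⟨i, _ | _⟩
    · rw [← a_def, hxa, hEs, Equiv.refl_symm, Equiv.refl_apply]
      by_cases hi : i = j
      · subst hi; simp [Pi.single_neg]
      · simp [hi]
    · rw [← b_def, hxb, hEs, Equiv.refl_symm, Equiv.refl_apply]
      by_cases hi : i = j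
      · subst hi; simp [Pi.single_neg]
      · simp [hi]

/-! ## The meridian twist `bⱼ ↦ bⱼaⱼ` -/

/-- **The meridian twist** of handle `j` (ZVC 3.6.9 (A)): `bⱼ ↦ bⱼaⱼ`, all other letters fixed
(inverse `bⱼ ↦ bⱼaⱼ⁻¹`), fixing `[aⱼ,bⱼ]` on the nose.  It stabilises every cut kernel which cuts
`aⱼ` on handle `j` and realises `moveX j 1 : δ_{bⱼ} ↦ δ_{bⱼ} + δ_{aⱼ}` on `H₁`.
[cite: ZieschangVogtColdewey1980, 3.6.9 (A)] -/
theorem exists_realises_moveX_cut (j : Fin g) :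
    ∃ x : SurfaceGroup g ≃* SurfaceGroup g,
      (∀ c : Fin g → Bool, c j = false → (cutKernel c).map x.toMonoidHom = cutKernel c) ∧
      ∀ s, toAdd (SurfaceGroup.abelianize g (x s)) = moveX j 1 (toAdd (SurfaceGroup.abelianize g s)) := by
  let x : SurfaceGroup g ≃* SurfaceGroup g :=
    equivOfGens
      (localGens a (fun i => if i = j then b j * a j else b i))
      (localGens a (fun i => if i = j then b j * (a j)⁻¹ else b i))
      (prod_relFactor_localGens _ _ fun i => by
        by_cases hi : i = j
        · subst hi; simp only [if_true]; group
        · simp [hi])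
      (prod_relFactor_localGens _ _ fun i => by
        by_cases hi : i = j
        · subst hi; simp only [if_true]; group
        · simp [hi])
      (by
        rintro ⟨i, _ | _⟩
        · rw [← a_def]; simp
        · by_cases hi : i = j
          · subst hi; rw [← b_def]; simp [map_mul]
          · rw [← b_def]; simp [hi])
      (by
        rintro ⟨i, _ | _⟩
        · rw [← a_def]; simp
        · by_cases hi : i = j
          · subst hi; rw [← b_def]; simp [map_mul, map_inv]
          · rw [← b_def]; simp [hi])
  have hxa : ∀ i, x (a i) = a i := fun i => by simp [x, a_def i]
  have hxb : ∀ i, x (b i) = if i = j then b j * a j else b i := fun i => by simp [x, b_def i]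
  have hxa' : ∀ i, x.symm (a i) = a i := fun i => by simp [x, a_def i]
  have hxb' : ∀ i, x.symm (b i) = if i = j then b j * (a j)⁻¹ else b i := fun i => by simp [x, b_def i]
  refine ⟨x, fun c hcj => ?_, ?_⟩
  · refine map_cutKernel_eq_of x c c (fun i => ?_) (fun i => ?_)
    · by_cases hi : i = j
      · subst hi
        rw [hcj, ← a_def, hxa]
        exact erase_a_of_eq_false c hcj
      · cases hc : c i
        · rw [← a_def, hxa]; exact erase_a_of_eq_false c hc
        · rw [← b_def, hxb, if_neg hi]; exact erase_b_of_eq_true c hc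
    · by_cases hi : i = j
      · subst hi
        rw [hcj, ← a_def, hxa']
        exact erase_a_of_eq_false c hcj
      · cases hc : c i
        · rw [← a_def, hxa']; exact erase_a_of_eq_false c hc
        · rw [← b_def, hxb', if_neg hi]; exact erase_b_of_eq_true c hc
  · refine abelianize_comp_eq_of_apply_of x _ ?_
    rintro ⟨i, _ | _⟩
    · rw [← a_def, hxa, moveX_single_of_ne _ _ (by simp)]
      simp
    · rw [← b_def, hxb]
      by_cases hi : i = j
      · subst hi
        rw [if_pos rfl, moveX_single_true, one_smul, map_mul, toAdd_mul, abelianize_a, abelianize_b,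
          toAdd_ofAdd, toAdd_ofAdd]
      · rw [if_neg hi, moveX_single_of_ne _ _ (by simpa using hi)]
        simp

/-! ## The cut swap on homology -/

/-- **The homology action of the cut swap**: `cutSwapEquiv d` (`aᵢ ↦ aᵢbᵢaᵢ⁻¹`, `bᵢ ↦ aᵢ⁻¹` on
the handles with `d i`) realises the quarter rotation `J_d` of the handles of `d`:
`δ_{aᵢ} ↦ δ_{bᵢ}`, `δ_{bᵢ} ↦ -δ_{aᵢ}` (`(J v)_{aᵢ} = -v_{bᵢ}`, `(J v)_{bᵢ} = v_{aᵢ}`), identity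
on the other handles. [folklore] -/
theorem exists_realises_cutSwapEquiv (d : Fin g → Bool) :
    ∃ J : (surfaceGen g → ℤ) ≃ₗ[ℤ] (surfaceGen g → ℤ),
      (∀ v p, J v p = if d p.1 then (if p.2 then v (p.1, false) else -v (p.1, true)) else v p) ∧
      ∀ s, toAdd (SurfaceGroup.abelianize g (cutSwapEquiv d s)) =
        J (toAdd (SurfaceGroup.abelianize g s)) := by
  -- `J` is the signed permutation `τ (i, s) = (i, ¬ s)`, `σ (i, false) = -1` on the handles of `d`
  have hτ : Function.Involutive fun p : surfaceGen g => if d p.1 then (p.1, !p.2) else p := by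
    rintro ⟨i, s⟩
    by_cases hd : d i <;> simp [hd]
  obtain ⟨J, hJ, hJs⟩ := exists_signedPerm (hτ.toPerm _)
    (fun p => if d p.1 ∧ p.2 = false then -1 else 1) (fun p => by
      by_cases h : d p.1 ∧ p.2 = false
      · exact Or.inr (if_pos h)
      · exact Or.inl (if_neg h))
  have hJ' : ∀ v p, J v p = if d p.1 then (if p.2 then v (p.1, false) else -v (p.1, true)) else v p := by
    rintro v ⟨i, s⟩
    rw [hJ]
    simp only [Function.Involutive.coe_toPerm]
    by_cases hd : d i <;> cases s <;> simp [hd]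
  refine ⟨J, hJ', abelianize_comp_eq_of_apply_of _ J ?_⟩
  have hsymm : ∀ p, (hτ.toPerm _).symm p = if d p.1 then (p.1, !p.2) else p := fun p => by
    rw [Equiv.symm_apply_eq]
    simp only [Function.Involutive.coe_toPerm]
    exact (hτ p).symm
  rintro ⟨i, _ | _⟩
  · rw [← a_def, cutSwapEquiv_a, hJs, hsymm]
    by_cases hd : d i
    · simp only [hd, if_true, Bool.not_false, map_mul, map_inv, toAdd_mul, toAdd_inv, abelianize_a,
        abelianize_b, toAdd_ofAdd]
      simp
    · simp [hd]
  · rw [← b_def, cutSwapEquiv_b, hJs, hsymm]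
    by_cases hd : d i
    · simp only [hd, if_true, Bool.not_true, map_inv, toAdd_inv, abelianize_a, toAdd_ofAdd]
      simp [Pi.single_neg]
    · simp [hd]

end SurfaceGroup

end Literature.Topology.FourManifolds

end
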